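import Mathlib
import HarnessLib
import Literature.NumberTheory.GaloisRepresentations.LocalGaloisGroup
import Literature.NumberTheory.GaloisRepresentations.DecompositionGroupOfCompletion
import Literature.NumberTheory.GaloisRepresentations.AbsGaloisOuterConj
import Literature.NumberTheory.GaloisRepresentations.IntegralGaloisActionProofs
import Literature.NumberTheory.Automorphic.AdicCompletionLocalField

/-!
# Stub `stub_inertiaTransport` (line `local_clause_cut`, crux `EmptyWeightCore`, stmt-Langlands-17008)

**Base change transports inertia between the two places above a split prime.**  Let `F/ℚ` be a
quadratic (Galois) number field, `res = absGaloisRestrict ℚ F : Γ_F → Γ_ℚ` (normal image of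
index `2`), `τ ∈ Γ_ℚ` NOT in the image of `res`, so that its image `τ̄ = absGaloisQuot ℚ F τ` in
`Gal(F/ℚ)` is the non-trivial element (`absGaloisQuot_eq_one_iff`), and `θ_τ = absGaloisOuterConj ℚ F τ`
the outer automorphism `σ ↦ res⁻¹(τ res(σ) τ⁻¹)` of `Γ_F`.  For two distinct places `v ≠ w` of `F`
containing the rational prime `p` there is `g ∈ Γ_F` such that for every `σ` in the local inertia
group `I_{F_w} = absInertia (w.adicCompletion F)` the element `g⁻¹ θ_τ(res_w σ) g` is `res_v σ'`
for some `σ' ∈ I_{F_v}`.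

Proof.  Both `v` and `w` lie over `p ℤ`, so `Gal(F/ℚ)` (of order `2`) moves `w` to `v` by an
element `≠ 1`, which must be `τ̄`: `τ̄ • w = v`.  Let `𝔓_w = adicCompletionPrime F w`,
`𝔓_v = adicCompletionPrime F v` be the primes of `ℤ̄_F` cut out by the chosen embeddings
`F̄ → \bar F_w`, `F̄ → \bar F_v`; then `I_{𝔓_u} = res_u (I_{F_u})`
(`inertia_adicCompletionPrime_eq_map_absInertia`, Neukirch II (9.6)), `θ_τ (I_{𝔓_w}) = I_{τ ⋆ 𝔓_w}`
(`absGaloisOuterConj_mem_inertia_iff`) with `τ ⋆ 𝔓_w` above `τ̄ • w = v`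
(`outerConjIdeal_mem_primesAbove`), `τ ⋆ 𝔓_w = g • 𝔓_v` for some `g ∈ Γ_F` (transitivity,
`exists_smul_eq_of_mem_primesAbove_holds`, Neukirch I (9.1)) and `I_{g • 𝔓_v} = g I_{𝔓_v} g⁻¹`
(`Ideal.conj_mem_inertia_smul_iff`, Neukirch I (9.4)).

Reference: J. Neukirch, *Algebraic Number Theory* (1999), Ch. I §9 (9.1)–(9.4) and Ch. II §9
Prop. (9.6).  No `sorry`, no new definitions.
-/

-- project-wide option (lakefile weak.linter.dupNamespace); `Summit.Langlands.Langlands` is mandated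
set_option linter.dupNamespace false

noncomputable section

namespace Summit.Langlands.Langlands.Cruxes.EmptyWeightCore.LocalClauseCut

open Literature.NumberTheory.GaloisRepresentations Field IsDedekindDomain NumberField
open scoped Pointwise

section InertiaTransportHelpers

/-- In a type with exactly two elements, two elements different from a third one are equal.
[folklore] -/
theorem inertiaTransport_eq_of_ne_of_card_eq_two {α : Type*} {x a b : α} (h : Nat.card α = 2)
    (ha : a ≠ x) (hb : b ≠ x) : a = b :=
  ((Nat.card_eq_two_iff' x).1 h).unique ha hb

variable {F : Type} [Field F] [NumberField F]

/-- Two places of the Galois number field `F` containing the rational prime `p` both lie over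
`p ℤ`, hence are conjugate under `Gal(F/ℚ)` (Mathlib `Ideal.exists_smul_eq_of_isGaloisGroup`).
[cite: NeukirchANT1999, Ch. I §9 Prop. (9.1)] -/
theorem inertiaTransport_exists_algEquiv_smul_eq [IsGalois ℚ F] (p : ℕ) [Fact p.Prime]
    {v w : HeightOneSpectrum (𝓞 F)} (hv : ((p : ℕ) : 𝓞 F) ∈ v.asIdeal)
    (hw : ((p : ℕ) : 𝓞 F) ∈ w.asIdeal) : ∃ σ : F ≃ₐ[ℚ] F, σ • w = v := by
  haveI : IsGaloisGroup (F ≃ₐ[ℚ] F) ℤ (𝓞 F) := IsGaloisGroup.of_isFractionRing _ _ _ ℚ F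
  have hp : Prime (p : ℤ) := Nat.prime_iff_prime_int.mp Fact.out
  haveI : w.asIdeal.LiesOver (Ideal.span {(p : ℤ)}) :=
    (Ideal.liesOver_span_iff w.isPrime.ne_top hp).2 (by simpa using hw)
  haveI : v.asIdeal.LiesOver (Ideal.span {(p : ℤ)}) :=
    (Ideal.liesOver_span_iff v.isPrime.ne_top hp).2 (by simpa using hv)
  obtain ⟨σ, hσ⟩ := Ideal.exists_smul_eq_of_isGaloisGroup (Ideal.span {(p : ℤ)}) w.asIdeal
    v.asIdeal (F ≃ₐ[ℚ] F)
  exact ⟨σ, HeightOneSpectrum.ext hσ⟩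

/-- For `F/ℚ` quadratic, `τ ∈ Γ_ℚ` outside `res(Γ_F)` and two distinct places `v ≠ w` above `p`,
the image `τ̄ ∈ Gal(F/ℚ)` of `τ` swaps them: `τ̄ • w = v` (`Gal(F/ℚ)` has order `2` and both
`τ̄` and the element carrying `w` to `v` are `≠ 1`). [cite: NeukirchANT1999, Ch. I §9 Prop. (9.1)] -/
theorem inertiaTransport_absGaloisQuot_smul_eq [Algebra.IsQuadraticExtension ℚ F] [IsGalois ℚ F]
    (p : ℕ) [Fact p.Prime] {τ : absoluteGaloisGroup ℚ}
    (hτ : τ ∉ Set.range (absGaloisRestrict ℚ F)) {v w : HeightOneSpectrum (𝓞 F)} (hvw : v ≠ w)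
    (hv : ((p : ℕ) : 𝓞 F) ∈ v.asIdeal) (hw : ((p : ℕ) : 𝓞 F) ∈ w.asIdeal) :
    absGaloisQuot ℚ F τ • w = v := by
  obtain ⟨σ, hσ⟩ := inertiaTransport_exists_algEquiv_smul_eq p hv hw
  have hσ1 : σ ≠ 1 := by
    rintro rfl
    exact hvw (by rw [← hσ, one_smul])
  have hτ1 : absGaloisQuot ℚ F τ ≠ 1 := fun h ↦ by
    obtain ⟨g, hg⟩ := (absGaloisQuot_eq_one_iff ℚ F τ).1 h
    exact hτ ⟨g, hg⟩
  have hcard : Nat.card (F ≃ₐ[ℚ] F) = 2 := by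
    rw [IsGalois.card_aut_eq_finrank, Algebra.IsQuadraticExtension.finrank_eq_two]
  rw [inertiaTransport_eq_of_ne_of_card_eq_two hcard hτ1 hσ1, hσ]

end InertiaTransportHelpers

/-- **STUB D — base change transports inertia between the two places above `p`.**  `F/ℚ`
quadratic (Galois), `τ ∈ Γ_ℚ` NOT in `res(Γ_F)` (so `τ̄ ∈ Gal(F/ℚ)` is the non-trivial element),
`v ≠ w` two places of `F` above `p` (so `τ̄ • w = v`).  Then there is `g ∈ Γ_F` such that for every
`σ` in the local inertia group `I_{F_w}` the outer conjugate `θ_τ(res_w σ)` is `g · res_v(σ') · g⁻¹`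
for some `σ'` in `I_{F_v}`.  (`I_{𝔓_w} = res_w(I_{F_w})` for `𝔓_w = adicCompletionPrime F w`,
`inertia_adicCompletionPrime_eq_map_absInertia`; `θ_τ(I_𝔔) = I_{τ ⋆ 𝔔}` and `τ ⋆ 𝔓_w ∣ τ̄ • w = v`,
`absGaloisOuterConj_mem_inertia_iff`, `outerConjIdeal_mem_primesAbove`; transitivity of `Γ_F` on
`v.primesAbove`, `exists_smul_eq_of_mem_primesAbove_holds`; `I_{g • 𝔓} = g I_𝔓 g⁻¹`,
`Ideal.conj_mem_inertia_smul_iff`.)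
[cite: NeukirchANT1999, Ch. I §9 (9.1)–(9.4) and Ch. II §9 Prop. (9.6)] -/
theorem stub_inertiaTransport :
    ∀ (F : Type) [Field F] [NumberField F] [Algebra.IsQuadraticExtension ℚ F] [IsGalois ℚ F]
      (p : ℕ) [Fact p.Prime] (τ : absoluteGaloisGroup ℚ),
      τ ∉ Set.range (absGaloisRestrict ℚ F) →
      ∀ (v w : HeightOneSpectrum (𝓞 F)), v ≠ w →
        ((p : ℕ) : 𝓞 F) ∈ v.asIdeal → ((p : ℕ) : 𝓞 F) ∈ w.asIdeal →
        ∃ g : absoluteGaloisGroup F,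
          ∀ σ ∈ absInertia (w.adicCompletion F),
            ∃ σ' ∈ absInertia (v.adicCompletion F),
              absGaloisRestrict F (v.adicCompletion F) σ' =
                g⁻¹ * absGaloisOuterConj ℚ F τ (absGaloisRestrict F (w.adicCompletion F) σ) * g := by
  intro F _ _ _ _ p _ τ hτ v w hvw hv hw
  -- the primes of `ℤ̄_F` above `w` and `v` cut out by the chosen embeddings `F̄ → \bar F_w`, `\bar F_v`
  have h𝔓w := adicCompletionPrime_mem_primesAbove F w
  have h𝔓v := adicCompletionPrime_mem_primesAbove F v
  -- `τ ⋆ 𝔓_w` lies above `τ̄ • w = v`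
  have hconj : outerConjIdeal τ (adicCompletionPrime F w) ∈ v.primesAbove := by
    have h := outerConjIdeal_mem_primesAbove h𝔓w τ
    rwa [inertiaTransport_absGaloisQuot_smul_eq p hτ hvw hv hw] at h
  -- transitivity of `Γ_F` on the primes above `v`: `g • 𝔓_v = τ ⋆ 𝔓_w`
  obtain ⟨g, hg⟩ := HeightOneSpectrum.exists_smul_eq_of_mem_primesAbove_holds h𝔓v hconj
  refine ⟨g, fun σ hσ ↦ ?_⟩
  -- `res_w σ ∈ I_{𝔓_w}`
  have h1 : absGaloisRestrict F (w.adicCompletion F) σ ∈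
      (adicCompletionPrime F w).inertia (absoluteGaloisGroup F) := by
    rw [inertia_adicCompletionPrime_eq_map_absInertia]
    exact ⟨σ, hσ, rfl⟩
  -- `θ_τ (res_w σ) ∈ I_{τ ⋆ 𝔓_w} = I_{g • 𝔓_v}`
  have h2 : absGaloisOuterConj ℚ F τ (absGaloisRestrict F (w.adicCompletion F) σ) ∈
      (g • adicCompletionPrime F v).inertia (absoluteGaloisGroup F) := by
    rw [hg]
    exact (absGaloisOuterConj_mem_inertia_iff τ (adicCompletionPrime F w) _).2 h1
  -- `I_{g • 𝔓_v} = g I_{𝔓_v} g⁻¹`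
  have h3 : g⁻¹ * absGaloisOuterConj ℚ F τ (absGaloisRestrict F (w.adicCompletion F) σ) * g ∈
      (adicCompletionPrime F v).inertia (absoluteGaloisGroup F) :=
    (Ideal.conj_mem_inertia_smul_iff (adicCompletionPrime F v) g _).1 (by simpa [mul_assoc] using h2)
  -- `I_{𝔓_v} = res_v (I_{F_v})`
  rw [inertia_adicCompletionPrime_eq_map_absInertia, Subgroup.mem_map] at h3
  obtain ⟨σ', hσ', h⟩ := h3
  exact ⟨σ', hσ', h⟩

end Summit.Langlands.Langlands.Cruxes.EmptyWeightCore.LocalClauseCut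

end
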